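import Summits.CriticalPhenomena.Ising3DConformalLimit.Theorems.PerfectScreeningGaussianLimitNotScreenedRegressionDefs
import Summits.CriticalPhenomena.Ising3DConformalLimit.Theorems.PerfectScreeningGaussianLimitNotScreenedRieszBalayage
import Summits.CriticalPhenomena.Ising3DConformalLimit.Theorems.PerfectScreeningGaussianLimitNotScreenedRieszKernelPosDef
import Mathlib.MeasureTheory.Integral.DominatedConvergence
import HarnessLib

/-!
# Crux `GaussianLimitNotScreened` (stmt-CriticalPhenomena-13886), line `single-layer-linear-regression`:
# SHARPNESS of the Riesz balayage bound, `sup_φ Q_Δ(φ) = 1 − Δ` (registered stub `stub_contQSharp`)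

THEOREM-ONLY file. The landed bound C (`stub_rieszBalayageBound`) says `Q_Δ(φ) ≤ 1 − Δ` for every
continuous profile `φ` supported in a ball, where
`Q_Δ(φ) = contQ Δ φ = 2∫ φ(v)(1+|v|²)^{−Δ} dv − ∫∫ φ(v)φ(w)|v−w|^{−2Δ} dv dw` on `ℝ² = E2`,
`1/2 ≤ Δ < 1`. Here we prove that the bound is SHARP: for every `η > 0` some continuous, compactly
supported `φ` has `Q_Δ(φ) > 1 − Δ − η`.

Proof. The maximiser is M. Riesz' balayage density `ψ_Δ = ((1−Δ)/π)(1+|·|²)^{Δ−2}`: by the landed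
C2 (`stub_rieszBalayage`) `Kψ_Δ = p₁ := (1+|·|²)^{−Δ}` pointwise and `⟨ψ_Δ, p₁⟩ = 1 − Δ`, so formally
`Q_Δ(ψ_Δ) = 2(1−Δ) − (1−Δ) = 1 − Δ`; it is not compactly supported, so we truncate it with the radial
cutoff `χ_R(v) = max 0 (min 1 (R − |v|))` and let `R → ∞`. Both terms of `Q_Δ(ψ_Δ χ_R)` converge by
dominated convergence: the linear term is dominated by `ψ_Δ p₁ ∈ L¹`, the quadratic term — read on the
product `ℝ² × ℝ²` (Fubini, `integral_prod`) — by `ψ_Δ ⊗ ψ_Δ · K ∈ L¹(ℝ² × ℝ²)` (landed C1,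
`rieszPosDef_integrable_prod`).

References: N. S. Landkof, *Foundations of Modern Potential Theory* (1972), Ch. IV §5 [Landkof1972].
-/

noncomputable section

namespace Summit.CriticalPhenomena.Ising3DConformalLimit.Cruxes.GaussianLimitNotScreened.SingleLayerLinearRegression

open MeasureTheory Filter Topology
open Literature.Probability.LatticeModels

/-- Dominated convergence against a cutoff: if `χ_R → 1` pointwise with `|χ_R| ≤ 1` (each `χ_R`
a.e.-strongly measurable) and `g` is integrable, then `∫ χ_R g → ∫ g`. [folklore] -/
theorem contQSharp_tendsto_integral_cutoff {α : Type*} [MeasurableSpace α] {μ : Measure α}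
    {χ : ℕ → α → ℝ} {g : α → ℝ} (hχm : ∀ R, AEStronglyMeasurable (χ R) μ)
    (hχb : ∀ R x, |χ R x| ≤ 1) (hχl : ∀ x, Tendsto (fun R => χ R x) atTop (𝓝 1))
    (hg : Integrable g μ) :
    Tendsto (fun R => ∫ x, χ R x * g x ∂μ) atTop (𝓝 (∫ x, g x ∂μ)) := by
  refine tendsto_integral_of_dominated_convergence (fun x => ‖g x‖)
    (fun R => (hχm R).mul hg.aestronglyMeasurable) hg.norm
    (fun R => Eventually.of_forall fun x => ?_) (Eventually.of_forall fun x => ?_)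
  · rw [norm_mul]
    exact mul_le_of_le_one_left (norm_nonneg _) ((Real.norm_eq_abs _).trans_le (hχb R x))
  · simpa using (hχl x).mul_const (g x)

/-- The radial cutoff `χ_R(v) = max 0 (min 1 (R − |v|))` takes values in `[0, 1]`. [folklore] -/
theorem contQSharp_cutoff_mem (R : ℕ) (v : E2) :
    0 ≤ max 0 (min 1 ((R : ℝ) - ‖v‖)) ∧ max 0 (min 1 ((R : ℝ) - ‖v‖)) ≤ 1 :=
  ⟨le_max_left _ _, max_le zero_le_one (min_le_left _ _)⟩

/-- The radial cutoff satisfies `|χ_R| ≤ 1`. [folklore] -/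
theorem contQSharp_cutoff_abs_le (R : ℕ) (v : E2) : |max 0 (min 1 ((R : ℝ) - ‖v‖))| ≤ 1 := by
  rw [abs_of_nonneg (contQSharp_cutoff_mem R v).1]
  exact (contQSharp_cutoff_mem R v).2

/-- The radial cutoff `χ_R(v) → 1` as `R → ∞` (it equals `1` once `R ≥ |v| + 1`). [folklore] -/
theorem contQSharp_cutoff_tendsto (v : E2) :
    Tendsto (fun R : ℕ => max 0 (min 1 ((R : ℝ) - ‖v‖))) atTop (𝓝 1) := by
  refine tendsto_const_nhds.congr' ?_
  filter_upwards [tendsto_natCast_atTop_atTop.eventually_ge_atTop (‖v‖ + 1)] with R hR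
  rw [min_eq_left (by linarith), max_eq_right zero_le_one]

/-- The radial cutoff is continuous. [folklore] -/
theorem contQSharp_cutoff_continuous (R : ℕ) :
    Continuous (fun v : E2 => max 0 (min 1 ((R : ℝ) - ‖v‖))) :=
  continuous_const.max (continuous_const.min (continuous_const.sub continuous_norm))

/-- The radial cutoff vanishes outside the ball of radius `R`. [folklore] -/
theorem contQSharp_cutoff_eq_zero (R : ℕ) (v : E2) (hv : (R : ℝ) ≤ ‖v‖) :
    max 0 (min 1 ((R : ℝ) - ‖v‖)) = 0 :=
  max_eq_left ((min_le_right _ _).trans (by linarith))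

/-- **Registered stub `stub_contQSharp`: sharpness of the Riesz balayage bound.** For `1/2 ≤ Δ < 1`
and every `η > 0` there is a continuous profile `φ` on `ℝ²` vanishing outside a ball with
`Q_Δ(φ) > 1 − Δ − η`; together with the landed bound `Q_Δ ≤ 1 − Δ` (`stub_rieszBalayageBound`) the
supremum of the continuum functional over such profiles is exactly `1 − Δ`. The witnesses are the
truncations `ψ_Δ χ_R` of M. Riesz' balayage density `ψ_Δ = ((1−Δ)/π)(1+|·|²)^{Δ−2}`, for which
`Q_Δ(ψ_Δ χ_R) → 2⟨ψ_Δ, p₁⟩ − ⟨ψ_Δ, Kψ_Δ⟩ = 1 − Δ` by dominated convergence.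
[cite: Landkof1972, Chapter IV §5] -/
theorem stub_contQSharp : ∀ Δ : ℝ, 1 / 2 ≤ Δ → Δ < 1 → ∀ η : ℝ, 0 < η → ∃ (φ : E2 → ℝ) (R : ℕ), Continuous φ ∧ (∀ v : E2, (R : ℝ) ≤ ‖v‖ → φ v = 0) ∧ 1 - Δ - η < contQ Δ φ := by
  intro Δ hΔ hΔ1 η hη
  obtain ⟨hbal, hmass⟩ := stub_rieszBalayage Δ hΔ hΔ1
  have hΔ0 : 0 < Δ := by linarith
  have h1Δ : 0 < 1 - Δ := by linarith
  have hπ : Real.pi ≠ 0 := Real.pi_pos.ne'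
  -- the balayage density `ψ = c (1+|·|²)^{Δ-2}`, `c = (1-Δ)/π`
  set c : ℝ := (1 - Δ) / Real.pi with hc
  have hc0 : 0 ≤ c := div_nonneg h1Δ.le Real.pi_pos.le
  set ψ : E2 → ℝ := fun w => c * (1 + ‖w‖ ^ 2) ^ (Δ - 2) with hψ
  have hbase : ∀ w : E2, 0 < 1 + ‖w‖ ^ 2 := fun w => by positivity
  have hψc : Continuous ψ := by
    refine continuous_const.mul ?_
    exact (continuous_const.add (continuous_norm.pow 2)).rpow_const fun w => Or.inl (hbase w).ne'
  have hψ0 : ∀ w : E2, 0 ≤ ψ w := fun w => mul_nonneg hc0 (Real.rpow_nonneg (hbase w).le _)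
  have hψC : ∀ w : E2, |ψ w| ≤ c * (1 + ‖w‖ ^ 2) ^ (Δ - 2) := fun w =>
    (abs_of_nonneg (hψ0 w)).le
  have hψb : ∀ w : E2, |ψ w| ≤ c := fun w => (hψC w).trans (mul_le_of_le_one_right hc0
    (Real.rpow_le_one_of_one_le_of_nonpos (le_add_of_nonneg_right (sq_nonneg _)) (by linarith)))
  have hψi : Integrable ψ := by
    have h2 : (Module.finrank ℝ (EuclideanSpace ℝ (Fin 2)) : ℝ) < 4 - 2 * Δ := by
      rw [finrank_euclideanSpace_fin]; push_cast; linarith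
    refine ((integrable_rpow_neg_one_add_norm_sq (μ := volume) h2).const_mul c).mono'
      hψc.aestronglyMeasurable (Eventually.of_forall fun w => ?_)
    rw [Real.norm_eq_abs, show -(4 - 2 * Δ) / 2 = Δ - 2 by ring]
    exact hψC w
  -- `Kψ = p₁` pointwise (C2, balayage identity)
  have hKψ : ∀ v : E2, ∫ w : E2, ψ w * ‖v - w‖ ^ (-(2 * Δ)) = (1 + ‖v‖ ^ 2) ^ (-Δ) := by
    intro v
    have : (fun w : E2 => ψ w * ‖v - w‖ ^ (-(2 * Δ))) =
        fun w : E2 => c * ((1 + ‖w‖ ^ 2) ^ (Δ - 2) * ‖v - w‖ ^ (-(2 * Δ))) := by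
      funext w; simp only [hψ]; ring
    rw [this, integral_const_mul, hbal v, hc]
    field_simp
  -- `⟨ψ, p₁⟩ = 1 - Δ` (C2, mass identity), and `ψ p₁ ∈ L¹`
  have hg_int : ∫ v : E2, ψ v * (1 + ‖v‖ ^ 2) ^ (-Δ) = 1 - Δ := by
    have e : (fun v : E2 => ψ v * (1 + ‖v‖ ^ 2) ^ (-Δ)) =
        fun v : E2 => c * ((1 + ‖v‖ ^ 2) ^ (Δ - 2) * (1 + ‖v‖ ^ 2) ^ (-Δ)) := by
      funext v; simp only [hψ]; ring
    rw [e, integral_const_mul, hmass, hc]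
    field_simp
  have hgi : Integrable (fun v : E2 => ψ v * (1 + ‖v‖ ^ 2) ^ (-Δ)) :=
    Integrable.of_integral_ne_zero (by rw [hg_int]; exact h1Δ.ne')
  -- `ψ ⊗ ψ · K ∈ L¹(ℝ² × ℝ²)` (C1) and `⟨ψ, Kψ⟩ = ⟨ψ, p₁⟩ = 1 - Δ`
  have hGi : Integrable (fun p : E2 × E2 => ψ p.1 * ψ p.2 * ‖p.1 - p.2‖ ^ (-(2 * Δ))) :=
    rieszPosDef_integrable_prod hΔ0 hΔ1 hψc hψc hψi hψi hψb
  have hG_int : ∫ p : E2 × E2, ψ p.1 * ψ p.2 * ‖p.1 - p.2‖ ^ (-(2 * Δ)) = 1 - Δ := by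
    have e1 : ∫ p : E2 × E2, ψ p.1 * ψ p.2 * ‖p.1 - p.2‖ ^ (-(2 * Δ)) =
        ∫ v : E2, ∫ w : E2, ψ v * ψ w * ‖v - w‖ ^ (-(2 * Δ)) := integral_prod _ hGi
    have hstep : ∀ v : E2, ∫ w : E2, ψ v * ψ w * ‖v - w‖ ^ (-(2 * Δ)) =
        ψ v * (1 + ‖v‖ ^ 2) ^ (-Δ) := by
      intro v
      have : (fun w : E2 => ψ v * ψ w * ‖v - w‖ ^ (-(2 * Δ))) =
          fun w : E2 => ψ v * (ψ w * ‖v - w‖ ^ (-(2 * Δ))) := by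
        funext w; ring
      rw [this, integral_const_mul, hKψ v]
    rw [e1]
    simp only [hstep]
    exact hg_int
  -- the truncated profiles `φ_R = ψ χ_R`
  set φ : ℕ → E2 → ℝ := fun R v => ψ v * max 0 (min 1 ((R : ℝ) - ‖v‖)) with hφ
  have hφc : ∀ R, Continuous (φ R) := fun R => hψc.mul (contQSharp_cutoff_continuous R)
  have hφs : ∀ (R : ℕ) (v : E2), (R : ℝ) ≤ ‖v‖ → φ R v = 0 := by
    intro R v hv
    simp only [hφ, contQSharp_cutoff_eq_zero R v hv, mul_zero]
  -- (i) the linear term: `⟨φ_R, p₁⟩ → ⟨ψ, p₁⟩ = 1 - Δ`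
  have hA : Tendsto (fun R : ℕ => ∫ v : E2, φ R v * (1 + ‖v‖ ^ 2) ^ (-Δ)) atTop (𝓝 (1 - Δ)) := by
    have key := contQSharp_tendsto_integral_cutoff (μ := (volume : Measure E2))
      (fun R => (contQSharp_cutoff_continuous R).aestronglyMeasurable)
      contQSharp_cutoff_abs_le contQSharp_cutoff_tendsto hgi
    rw [hg_int] at key
    refine key.congr fun R => ?_
    refine integral_congr_ae (Eventually.of_forall fun v => ?_)
    simp only [hφ]; ring
  -- (ii) the quadratic term: `⟨φ_R, Kφ_R⟩ → ⟨ψ, Kψ⟩ = 1 - Δ` (on the product space)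
  have hB : Tendsto (fun R : ℕ => ∫ v : E2, ∫ w : E2, φ R v * φ R w * ‖v - w‖ ^ (-(2 * Δ)))
      atTop (𝓝 (1 - Δ)) := by
    have hχ2m : ∀ R : ℕ, AEStronglyMeasurable (fun p : E2 × E2 =>
        max 0 (min 1 ((R : ℝ) - ‖p.1‖)) * max 0 (min 1 ((R : ℝ) - ‖p.2‖))) volume := fun R =>
      (((contQSharp_cutoff_continuous R).comp continuous_fst).mul
        ((contQSharp_cutoff_continuous R).comp continuous_snd)).aestronglyMeasurable
    have hχ2b : ∀ (R : ℕ) (p : E2 × E2),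
        |max 0 (min 1 ((R : ℝ) - ‖p.1‖)) * max 0 (min 1 ((R : ℝ) - ‖p.2‖))| ≤ 1 := fun R p => by
      rw [abs_mul, abs_of_nonneg (contQSharp_cutoff_mem R p.1).1,
        abs_of_nonneg (contQSharp_cutoff_mem R p.2).1]
      exact mul_le_one₀ (contQSharp_cutoff_mem R p.1).2 (contQSharp_cutoff_mem R p.2).1
        (contQSharp_cutoff_mem R p.2).2
    have hχ2l : ∀ p : E2 × E2, Tendsto (fun R : ℕ =>
        max 0 (min 1 ((R : ℝ) - ‖p.1‖)) * max 0 (min 1 ((R : ℝ) - ‖p.2‖))) atTop (𝓝 1) :=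
      fun p => by simpa using (contQSharp_cutoff_tendsto p.1).mul (contQSharp_cutoff_tendsto p.2)
    have key := contQSharp_tendsto_integral_cutoff (μ := (volume : Measure (E2 × E2)))
      hχ2m hχ2b hχ2l hGi
    rw [hG_int] at key
    refine key.congr fun R => ?_
    have hGRi : Integrable (fun p : E2 × E2 => φ R p.1 * φ R p.2 * ‖p.1 - p.2‖ ^ (-(2 * Δ))) := by
      refine (hGi.bdd_mul (c := 1) (hχ2m R) (Eventually.of_forall fun p => ?_)).congr
        (Eventually.of_forall fun p => ?_)
      · rw [Real.norm_eq_abs]; exact hχ2b R p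
      · simp only [hφ]; ring
    have e2 : ∫ p : E2 × E2, φ R p.1 * φ R p.2 * ‖p.1 - p.2‖ ^ (-(2 * Δ)) =
        ∫ v : E2, ∫ w : E2, φ R v * φ R w * ‖v - w‖ ^ (-(2 * Δ)) := integral_prod _ hGRi
    rw [← e2]
    refine integral_congr_ae (Eventually.of_forall fun p => ?_)
    simp only [hφ]; ring
  -- (iii) `Q_Δ(φ_R) → 2(1 - Δ) - (1 - Δ) = 1 - Δ`; pick `R` large
  have hlim : Tendsto (fun R : ℕ => contQ Δ (φ R)) atTop (𝓝 (1 - Δ)) := by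
    have h := (hA.const_mul 2).sub hB
    rw [show (2 : ℝ) * (1 - Δ) - (1 - Δ) = 1 - Δ by ring] at h
    exact h
  obtain ⟨R, hR⟩ := (hlim.eventually (eventually_gt_nhds (by linarith : 1 - Δ - η < 1 - Δ))).exists
  exact ⟨φ R, R, hφc R, hφs R, hR⟩

end Summit.CriticalPhenomena.Ising3DConformalLimit.Cruxes.GaussianLimitNotScreened.SingleLayerLinearRegression

end
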